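import Summits.Ventures.PercRepro.S1PerFlatCount

/-!
# PercRepro — S1 THE RANK-`4` FOUR-SETS ARE `C(n, 4)` MINUS THE DEPENDENT ONES (lever L1; p2, gen 15; SUBCLAIM-S1 §6.3 (i))

Under «lines have `≤ 3` points», a `4`-set of `E` contains at most one triangle, so the dependent `4`-sets number at
least `s₃·(n − 3) + s₄`: the sets `T ∪ {z}` (`T` a triangle, `z ∉ T`) are pairwise distinct and are not `4`-circuits.
Hence the `4`-sets of rank `4` — the only size-`4` members of `U(p, 4)` — number at most `C(n, 4) − s₃·(n − 3) − s₄`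
(`CoreFourCounts.ncard_four_sets_le` is the opposite inequality, used on the `Y`-side).

* `eRk_insert_le_two_of_triangles` — two distinct triangles in a `4`-set force a rank-`≤ 2` set of `4` points;
* **`ncard_four_sets_rank_four_add_le`** — `#{X ⊆ E : |X| = 4, r(X) = 4} + s₃·(n − 3) + s₄ ≤ C(n, 4)`.
Axioms: standard.
-/

open scoped Matroid

namespace PercRepro

namespace S1

open Set

variable {α : Type}

/-- A triangle `T` and a point `z ∉ T` give a dependent `4`-set: `r(T ∪ {z}) ≤ 3`. -/
theorem eRk_insert_triangle_le_three (M : Matroid α) {T : Set α} (hT : M.IsCircuit T) (h3 : T.ncard = 3)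
    (z : α) : M.eRk (insert z T) ≤ 3 := by
  have hTfin : T.Finite := finite_of_ncard_pos (by omega)
  have hr : M.eRk T + 1 = 3 := by
    rw [hT.eRk_add_one_eq, ← hTfin.cast_ncard_eq, h3]; rfl
  have h2 : M.eRk T = 2 := by
    have : M.eRk T + 1 = 2 + 1 := by rw [hr]; norm_num
    exact WithTop.add_right_cancel ENat.one_ne_top this
  calc M.eRk (insert z T) ≤ M.eRk T + 1 := M.eRk_insert_le_add_one z T
    _ = 3 := by rw [h2]; norm_num

/-- **Two distinct triangles inside one `4`-set** `X = T ∪ {z} = T' ∪ {z'}` (`z ∉ T`, `z' ∉ T'`) put `X` inside the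
closure of the `2`-set `T ∖ {z'} = T' ∖ {z}`, so `r(X) ≤ 2`. -/
theorem eRk_le_two_of_two_triangles (M : Matroid α) {T T' : Set α} {z z' : α}
    (hT : M.IsCircuit T) (hT' : M.IsCircuit T') (h3 : T.ncard = 3) (h3' : T'.ncard = 3)
    (hz : z ∉ T) (hz' : z' ∉ T') (hne : T ≠ T') (heq : insert z T = insert z' T') :
    M.eRk (insert z T) ≤ 2 := by
  have hTfin : T.Finite := finite_of_ncard_pos (by omega)
  have hT'fin : T'.Finite := finite_of_ncard_pos (by omega)
  -- `z ≠ z'`, `z' ∈ T`, `z ∈ T'`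
  have hzz' : z ≠ z' := by
    intro h
    subst h
    apply hne
    have h1 : T = insert z T \ {z} := by
      rw [insert_sdiff_of_mem _ (mem_singleton z), sdiff_singleton_eq_self hz]
    have h2 : T' = insert z T' \ {z} := by
      rw [insert_sdiff_of_mem _ (mem_singleton z), sdiff_singleton_eq_self hz']
    rw [h1, h2, heq]
  have hz'T : z' ∈ T := by
    have : z' ∈ insert z T := by rw [heq]; exact mem_insert z' T'
    rcases this with h | h
    · exact absurd h.symm hzz'
    · exact h
  have hzT' : z ∈ T' := by
    have : z ∈ insert z' T' := by rw [← heq]; exact mem_insert z T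
    rcases this with h | h
    · exact absurd h hzz'
    · exact h
  -- the common `2`-set `S = T ∖ {z'} = T' ∖ {z}`
  have hS : T \ {z'} = T' \ {z} := by
    ext x
    constructor
    · rintro ⟨hxT, hxz'⟩
      rw [mem_singleton_iff] at hxz'
      have : x ∈ insert z' T' := by rw [← heq]; exact mem_insert_of_mem z hxT
      rcases this with h | h
      · exact absurd h hxz'
      · exact ⟨h, fun hx => hz (by rw [mem_singleton_iff] at hx; rw [← hx]; exact hxT)⟩
    · rintro ⟨hxT', hxz⟩
      rw [mem_singleton_iff] at hxz
      have : x ∈ insert z T := by rw [heq]; exact mem_insert_of_mem z' hxT'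
      rcases this with h | h
      · exact absurd h hxz
      · exact ⟨h, fun hx => hz' (by rw [mem_singleton_iff] at hx; rw [← hx]; exact hxT')⟩
  -- everything lies in `cl(S)`
  have hz'cl : z' ∈ M.closure (T \ {z'}) := hT.mem_closure_sdiff_singleton_of_mem hz'T
  have hzcl : z ∈ M.closure (T \ {z'}) := by
    rw [hS]; exact hT'.mem_closure_sdiff_singleton_of_mem hzT'
  have hsub : insert z T ⊆ M.closure (T \ {z'}) := by
    intro x hx
    rcases hx with h | h
    · rw [h]; exact hzcl
    · by_cases hxz' : x = z'
      · rw [hxz']; exact hz'cl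
      · exact M.subset_closure _ ((sdiff_subset).trans hT.subset_ground) ⟨h, hxz'⟩
  -- `r(S) ≤ 2`
  have hScard : (T \ {z'}).encard = 2 := by
    rw [← (hTfin.sdiff).cast_ncard_eq, ncard_sdiff_singleton_of_mem hz'T, h3]; rfl
  calc M.eRk (insert z T) ≤ M.eRk (M.closure (T \ {z'})) := M.eRk_mono hsub
    _ = M.eRk (T \ {z'}) := M.eRk_closure_eq _
    _ ≤ (T \ {z'}).encard := M.eRk_le_encard _
    _ = 2 := hScard

/-- **THE RANK-`4` FOUR-SETS**: under «lines have `≤ 3` points»,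
`#{X ⊆ E : |X| = 4, r(X) = 4} + s₃·(n − 3) + s₄ ≤ C(n, 4)`. -/
theorem ncard_four_sets_rank_four_add_le (M : Matroid α) [M.Finite]
    (hline : ∀ L ⊆ M.E, M.eRk L ≤ 2 → L.ncard ≤ 3) :
    {X : Set α | X ⊆ M.E ∧ X.ncard = 4 ∧ M.eRk X = 4}.ncard +
      ({C : Set α | M.IsCircuit C ∧ C.ncard = 3}.ncard * (M.E.ncard - 3) +
        {C : Set α | M.IsCircuit C ∧ C.ncard = 4}.ncard) ≤ M.E.ncard.choose 4 := by
  classical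
  set Ef := M.ground_finite.toFinset with hEf
  have hE : (Ef : Set α) = M.E := Set.Finite.coe_toFinset _
  have hEcard : Ef.card = M.E.ncard := (Set.ncard_eq_toFinset_card _ M.ground_finite).symm
  -- the `4`-subsets of `E`
  set 𝓑 : Finset (Set α) := (Ef.powersetCard 4).image (fun s : Finset α => (s : Set α)) with h𝓑
  have h𝓑card : 𝓑.card = M.E.ncard.choose 4 := by
    rw [h𝓑]; exact card_image_powersetCard M.ground_finite 4
  have hmem𝓑 : ∀ X, X ∈ 𝓑 ↔ X ⊆ M.E ∧ X.ncard = 4 := fun X =>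
    mem_image_powersetCard_iff M.ground_finite 4 X
  set R := 𝓑.filter (fun X => M.eRk X = 4) with hR
  set D := 𝓑.filter (fun X => ¬ M.eRk X = 4) with hD
  have hRD : R.card + D.card = 𝓑.card := by
    rw [hR, hD]; exact Finset.card_filter_add_card_filter_not _
  have hRset : {X : Set α | X ⊆ M.E ∧ X.ncard = 4 ∧ M.eRk X = 4}.ncard = R.card := by
    rw [← Set.ncard_coe_finset]
    congr 1
    ext X
    rw [Finset.mem_coe, hR, Finset.mem_filter, hmem𝓑]
    simp only [Set.mem_setOf_eq, and_assoc]
  -- the triangles and the `4`-circuits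
  have hcircfin : ∀ k : ℕ, {C : Set α | M.IsCircuit C ∧ C.ncard = k}.Finite := fun k =>
    M.ground_finite.finite_subsets.subset (fun C hC => hC.1.subset_ground)
  set T3 := (hcircfin 3).toFinset with hT3
  set F4 := (hcircfin 4).toFinset with hF4
  have hT3card : T3.card = {C : Set α | M.IsCircuit C ∧ C.ncard = 3}.ncard :=
    (Set.ncard_eq_toFinset_card _ (hcircfin 3)).symm
  have hF4card : F4.card = {C : Set α | M.IsCircuit C ∧ C.ncard = 4}.ncard :=
    (Set.ncard_eq_toFinset_card _ (hcircfin 4)).symm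
  have hmemT3 : ∀ T, T ∈ T3 ↔ M.IsCircuit T ∧ T.ncard = 3 := fun T => by
    rw [hT3, Set.Finite.mem_toFinset]; rfl
  have hmemF4 : ∀ C, C ∈ F4 ↔ M.IsCircuit C ∧ C.ncard = 4 := fun C => by
    rw [hF4, Set.Finite.mem_toFinset]; rfl
  -- the image `T ∪ {z}`, `z ∈ E ∖ T`
  set g : Set α → Finset (Set α) := fun T =>
    ((M.ground_finite.sdiff (t := T)).toFinset).image (fun z => insert z T) with hg
  have hgcard : ∀ T ∈ T3, (g T).card = M.E.ncard - 3 := by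
    intro T hT
    rw [hmemT3] at hT
    rw [hg]
    simp only
    rw [Finset.card_image_of_injOn]
    · have hTE : T ⊆ M.E := hT.1.subset_ground
      rw [← Set.ncard_eq_toFinset_card _ (M.ground_finite.sdiff (t := T)), Set.ncard_sdiff' hTE M.ground_finite, hT.2]
    · intro z hz z' hz' h
      rw [Finset.mem_coe, Set.Finite.mem_toFinset] at hz hz'
      have h' : insert z T = insert z' T := h
      have : z ∈ insert z' T := by rw [← h']; exact mem_insert z T
      rcases this with h1 | h1
      · exact h1
      · exact absurd h1 hz.2
  have hgsub : ∀ T ∈ T3, g T ⊆ D := by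
    intro T hT X hX
    have hT' := (hmemT3 T).1 hT
    rw [hg] at hX
    simp only [Finset.mem_image, Set.Finite.mem_toFinset] at hX
    obtain ⟨z, hz, rfl⟩ := hX
    rw [hD, Finset.mem_filter, hmem𝓑]
    have hTfin : T.Finite := M.ground_finite.subset hT'.1.subset_ground
    refine ⟨⟨insert_subset hz.1 hT'.1.subset_ground, ?_⟩, ?_⟩
    · rw [ncard_insert_of_notMem hz.2 hTfin, hT'.2]
    · intro h4
      have := eRk_insert_triangle_le_three M hT'.1 hT'.2 z
      rw [h4] at this
      norm_num at this
  -- the images of distinct triangles are disjoint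
  have hgdisj : (T3 : Set (Set α)).PairwiseDisjoint g := by
    intro T hT T' hT' hne
    rw [Function.onFun, Finset.disjoint_left]
    intro X hX hX'
    have hTT := (hmemT3 T).1 (Finset.mem_coe.1 hT)
    have hTT' := (hmemT3 T').1 (Finset.mem_coe.1 hT')
    rw [hg] at hX hX'
    simp only [Finset.mem_image, Set.Finite.mem_toFinset] at hX hX'
    obtain ⟨z, hz, rfl⟩ := hX
    obtain ⟨z', hz', heq⟩ := hX'
    have hle := eRk_le_two_of_two_triangles M hTT.1 hTT'.1 hTT.2 hTT'.2 hz.2 hz'.2 hne heq.symm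
    have hXE : insert z T ⊆ M.E := insert_subset hz.1 hTT.1.subset_ground
    have hTfin : T.Finite := M.ground_finite.subset hTT.1.subset_ground
    have h4 : (insert z T).ncard = 4 := by rw [ncard_insert_of_notMem hz.2 hTfin, hTT.2]
    have := hline _ hXE hle
    omega
  -- the `4`-circuits lie in `D` and avoid the image
  have hF4sub : F4 ⊆ D := by
    intro C hC
    have hC' := (hmemF4 C).1 hC
    rw [hD, Finset.mem_filter, hmem𝓑]
    refine ⟨⟨hC'.1.subset_ground, hC'.2⟩, ?_⟩
    intro h4
    have hCfin : C.Finite := M.ground_finite.subset hC'.1.subset_ground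
    have := hC'.1.eRk_add_one_eq
    rw [h4, ← hCfin.cast_ncard_eq, hC'.2] at this
    norm_num at this
  have hF4disj : Disjoint (T3.biUnion g) F4 := by
    rw [Finset.disjoint_left]
    intro X hX hXF
    rw [Finset.mem_biUnion] at hX
    obtain ⟨T, hT, hXT⟩ := hX
    have hTT := (hmemT3 T).1 hT
    have hC := (hmemF4 X).1 hXF
    rw [hg] at hXT
    simp only [Finset.mem_image, Set.Finite.mem_toFinset] at hXT
    obtain ⟨z, hz, rfl⟩ := hXT
    have hss : T ⊂ insert z T := ssubset_insert hz.2
    exact hTT.1.not_indep (hC.1.ssubset_indep hss)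
  -- count
  have himg : (T3.biUnion g).card = {C : Set α | M.IsCircuit C ∧ C.ncard = 3}.ncard * (M.E.ncard - 3) := by
    rw [Finset.card_biUnion hgdisj, ← hT3card]
    rw [Finset.card_eq_sum_ones T3, Finset.sum_mul]
    apply Finset.sum_congr rfl
    intro T hT
    rw [one_mul, hgcard T hT]
  have hDge : (T3.biUnion g).card + F4.card ≤ D.card := by
    rw [← Finset.card_union_of_disjoint hF4disj]
    apply Finset.card_le_card
    apply Finset.union_subset _ hF4sub
    intro X hX
    rw [Finset.mem_biUnion] at hX
    obtain ⟨T, hT, hXT⟩ := hX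
    exact hgsub T hT hXT
  rw [hRset, ← h𝓑card, ← hRD, ← hF4card, ← himg]
  omega

end S1

end PercRepro
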